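import Summits.BirchSwinnertonDyer.BirchSwinnertonDyer.Theorems.PrintX8LayeredStevensCollapse
import Summits.BirchSwinnertonDyer.BirchSwinnertonDyer.Theses.PrintX8
import HarnessLib

/-!
# Route `PrintX8`, crux `SharpFlatMuAnSmallImageX8` (An, stmt-BirchSwinnertonDyer-20714): the LAYERED-STEVENS
# road to the crux BY NAME — the two-layer carrier «unit winding-symbol differences at two consecutive
# `3`-power layers on every X8 pair» ⟹ `Theses.PrintX8.SharpFlatMuAnSmallImageX8`; hence, with the route's
# closed glue 20716 and input 20771 by name, `Theses.PrintX8.MuBoundSmallImageX8`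
# (cell `bsd-print-x8`, D-0131 (2) print tier, prover seat p3 g3; `--supports` 20714, closes nothing)

PARTITION (cell bsd-print-x8, leaf `ClassX8`): a BY-NAME CLOSER ROAD of crux 20714 An (planner PLAN v1.9 §2/§7:
LINE «layered Stevens at 3» is filed as evidence + turnkeys, NOT as items; no route change asked).  Closes NO
item — the carrier is an OPEN hypothesis (⟸ LS-B, seat p1's bridge ⟸ LS-0 = Sun 2007 §4 Conj. 8 at
`(p, ℓ) = (3, 3)` mod `3`, Eisenstein-refined, an open printed conjecture; kit j287967: all 657 levels `N ≤ 1000`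
prime to `3` have two consecutive LAYER-OK layers) — and moves 0 census cells; BSD is not proved by any of this.
THEOREMS ONLY; imports the route file and route-independent modules only (theses-cone hygiene).
beyond-print: yes (the reduction «LS carrier ⟹ Perrin-Riou's Conj. 7.1 on the whole X8 family» is a kernel
theorem; part of it is `PrintX8LayeredStevensCollapse`).

THE ROAD (memo `run/shared/lean/pub/bsd-print-x8/plan/ls/LINE-LAYERED-STEVENS-AT-3.md` §2):
  «∀ X8 pairs, `CycWindingUnitTwoLayersAt W 3`» (class-wide two-layer carrier; tree def of ty2 g5, p561961)
    ⟹ (`PrintX8LayeredStevensCollapse.ClassX8.forall_chromaticL_muZero_of_cycWindingUnitTwoLayersAt`: the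
       two-layer collapse at EVERY newform of `W` — no Carayol level transport — and every Sprung pair)
  `Theses.PrintX8.SharpFlatMuAnSmallImageX8` (item 20714 An, BOTH colours: `L^• ≠ 0 ⟹` unit content; indeed
  the stronger `L^• ≠ 0 ∧ μ(L^•) = 0` unconditionally in `•`) BY NAME
    ⟹ (item 20716 `GlueMuAnSmallImageX8`, CLOSED, taken by name + item 20771 `InputSharpFlatMuTransfer`, held)
  `Theses.PrintX8.MuBoundSmallImageX8` (item 20622) BY NAME.
`sharpFlatMuAnSmallImageX8_of_bridgeLS_of_layeredStevens`: the same from LS-0(3) (`LayeredStevensModAt 3` of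
`SketchLS.lean`, spelled out) and the bridge LS-B (`BridgeLS W 3`, spelled out; seat p1's turnkey), i.e. the
REDUCTION «Sun's Conj. 8 at (3,3) + LS-B ⟹ An on all of X8» as one kernel theorem.  The `¬ Surj` binder of An
is carried, not used (the mechanism is image-free).

References: [Sun2007] §4 Conj. 8, Example 9; [PerrinRiou2003] §6.1 Conj. 6.1.1 / §7.1 Conj. 7.1; [Pollack2003]
Def. 6.15, Prop. 6.9–6.10; [Sprung2017] Cor. 4.10, Thm. 1.12; [Kurihara2002] Thm. 0.1; files `Theses/PrintX8.lean`
(rev 17), `Theorems/PrintX8LayeredStevensCollapse.lean` (this seat), `Literature/…/Rank1Residual/CyclotomicWindingSpan.lean`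
(p557383/p561961), planner memo + `SketchLS.lean` (plan g5).
-/

set_option autoImplicit false
-- justification: the mandated namespace `Summit.BirchSwinnertonDyer.BirchSwinnertonDyer.Theorems`
-- (single-conjunct summit, Sub = Summit) repeats a segment by design (D-0017).
set_option linter.dupNamespace false

noncomputable section

open scoped Classical MatrixGroups ModularForm

open CongruenceSubgroup WeierstrassCurve Literature.NumberTheory.EllipticCurves
  Literature.NumberTheory.EllipticCurves.ModularForms
  Literature.NumberTheory.EllipticCurves.Sprung2017
  Literature.NumberTheory.EllipticCurves.Rank1Residual
  Literature.NumberTheory.EllipticCurves.GreenbergVatsal2000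
  Summit.BirchSwinnertonDyer.Rank1Residual.Supersingular
  Summit.BirchSwinnertonDyer.BirchSwinnertonDyer.Theorems.PrintX8LayeredStevensCollapse

namespace Summit.BirchSwinnertonDyer.BirchSwinnertonDyer.Theorems.PrintX8LayeredStevens

/-- **Crux 20714 An BY NAME from the class-wide two-layer carrier**: if every Class-X8 curve satisfies
`CycWindingUnitTwoLayersAt W p` (unit winding-symbol differences at two consecutive `3`-power layers for
every newform), then `Theses.PrintX8.SharpFlatMuAnSmallImageX8` — for every X8 pair with non-surjective image,
every colour, every newform (any level) and every Sprung pair, `L^• ≠ 0 ⟹ L^•` has unit content.  Proof: the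
two-layer collapse `ClassX8.forall_chromaticL_muZero_of_cycWindingUnitTwoLayersAt` (unit content of BOTH colours,
unconditionally in `•`; `¬ Surj` unused). [cite: PerrinRiou2003, §7.1 Conjecture 7.1] [cite: Sun2007, §4 Conj. 8]
[cite: Sprung2017, Cor. 4.10 and Thm. 1.12] -/
theorem sharpFlatMuAnSmallImageX8_of_cycWindingUnitTwoLayersX8
    (hLS : ∀ (W : WeierstrassCurve ℚ) [W.IsElliptic] [W.IsGloballyMinimal] (p : ℕ) [Fact p.Prime],
      ClassX8 W p → CycWindingUnitTwoLayersAt W p) :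
    Theses.PrintX8.SharpFlatMuAnSmallImageX8 := by
  intro W _ _ p _ hX _ col N hN f Lsharp Lflat hf hSP _
  haveI := hN
  exact (ClassX8.forall_chromaticL_muZero_of_cycWindingUnitTwoLayersAt hX (hLS W p hX) hf hSP col).2.2.1

/-- **Crux 20622 `MuBoundSmallImageX8` BY NAME from the class-wide two-layer carrier**, through the route's
CLOSED glue item 20716 `GlueMuAnSmallImageX8` (An → InputSharpFlatMuTransfer → Mu, taken by name; proved by
`PrintX8MuAnGlue.glueMuAnSmallImageX8_holds`) and the held input item 20771 `InputSharpFlatMuTransfer`.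
[cite: PerrinRiou2003, §7.1 Conjecture 7.1] [cite: Sprung2012, Def. 6.1, Thm. 7.14 and Prop. 7.19] [cite: Sun2007, §4 Conj. 8] -/
theorem muBoundSmallImageX8_of_glue_of_cycWindingUnitTwoLayersX8 (hGlue : Theses.PrintX8.GlueMuAnSmallImageX8)
    (hIn : Theses.PrintX8.InputSharpFlatMuTransfer)
    (hLS : ∀ (W : WeierstrassCurve ℚ) [W.IsElliptic] [W.IsGloballyMinimal] (p : ℕ) [Fact p.Prime],
      ClassX8 W p → CycWindingUnitTwoLayersAt W p) :
    Theses.PrintX8.MuBoundSmallImageX8 :=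
  hGlue (sharpFlatMuAnSmallImageX8_of_cycWindingUnitTwoLayersX8 hLS) hIn

/-- **THE REDUCTION «Sun 2007 Conj. 8 at (3,3) + the bridge LS-B ⟹ An on all of X8» as one kernel theorem.**
Hypotheses, both spelled out from `plan/ls/SketchLS.lean`: `hLSM` = LS-0(3) `LayeredStevensModAt 3` (every level
`N ≥ 1` prime to `3` has LAYER-EIS-SPAN mod `3` at all layers `m ≥ m₀(N)`; an OPEN printed conjecture, here a
hypothesis — never a Literature fact) and `hB` = the bridge `BridgeLS W 3` for every X8 curve (seat p1's turnkey:
two span-certified consecutive layers at the level of the newform + `a_3 ≢ 1 (mod 3)` ⟹ the two-layer carrier).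
Conclusion: `Theses.PrintX8.SharpFlatMuAnSmallImageX8` (item 20714).  Glue: `3 ∤ N` for the level of a newform
of an X8 curve (`not_dvd_level_of_isNewformOf`, good reduction at `3`), `a_3 − 1 ∈ {2, −4}`.
[cite: Sun2007, §4 Conj. 8] [cite: PerrinRiou2003, §7.1 Conjecture 7.1] -/
theorem sharpFlatMuAnSmallImageX8_of_bridgeLS_of_layeredStevens
    (hLSM : ∀ N : ℕ, 0 < N → ¬ 3 ∣ N → ∃ m₀ : ℕ, ∀ m : ℕ, m₀ ≤ m → LayerEisSpanModGen N 3 m)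
    (hB : ∀ (W : WeierstrassCurve ℚ) [W.IsElliptic] [W.IsGloballyMinimal], ClassX8 W 3 →
      (∀ {N : ℕ} [NeZero N] (f : CuspForm (Gamma0 N) 2), IsNewformOf W f → LayerEisSpanTwoModGen N 3) →
        ¬ ((3 : ℤ) ∣ W.frobeniusTrace 3 - 1) → CycWindingUnitTwoLayersAt W 3) :
    Theses.PrintX8.SharpFlatMuAnSmallImageX8 := by
  refine sharpFlatMuAnSmallImageX8_of_cycWindingUnitTwoLayersX8 fun W _ _ p _ hX ↦ ?_
  obtain ⟨hp3, hss, -⟩ := id hX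
  subst hp3
  have hgood : W.HasGoodReductionAtPrime 3 := hss.1
  have hpa : ¬ ((3 : ℤ) ∣ W.frobeniusTrace 3 - 1) := by
    intro h
    have h' : ((3 : ℕ) : ℤ) ∣ W.frobeniusTrace 3 - (W.frobeniusTrace 3 - 1) := dvd_sub hss.2 (by exact_mod_cast h)
    rw [sub_sub_cancel] at h'
    norm_num at h'
  have hLS0 : ∀ {N : ℕ} [NeZero N] (f : CuspForm (Gamma0 N) 2), IsNewformOf W f →
      LayerEisSpanTwoModGen N 3 := by
    intro N _ f hf
    obtain ⟨m₀, hm₀⟩ := hLSM N (Nat.pos_of_ne_zero (NeZero.ne N)) (not_dvd_level_of_isNewformOf hf hgood)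
    exact ⟨m₀ + 1, by omega, hm₀ _ (by omega), hm₀ _ (by omega)⟩
  have hLS : CycWindingUnitTwoLayersAt W 3 := hB W hX (fun f hf ↦ hLS0 f hf) hpa
  intro N hN f hf
  exact hLS f hf

end Summit.BirchSwinnertonDyer.BirchSwinnertonDyer.Theorems.PrintX8LayeredStevens

end
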